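import Summits.Ventures.PackingBounds.ThreePointCert.K9d12AggG1
import Summits.Ventures.PackingBounds.ThreePointCert.K9d12AggP

/-!
# κ(9) ≤ 364: kernel validation of Gram block R0 (chunks 10–12 of 18)

Framing: lottery ticket; floor = certified bounds/negative ranges. Venture `PackingBounds` (cell
`pub-packcert`), three-point SDP family, kissing column. Integer data / kernel checks of a feasible point of the
Bachoc–Vallentin semidefinite program (n = 9, s = 1/2, three-point matrix degree 12, two-point (Gegenbauer) part to
degree L = 24, Bachoc–Vallentin multiplier set = cell mode sym2; exact rational certificate `sdp-n9-d12-s1-2-sym2-a24-hyb7-j143227.json`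
(sha256 312f8e786f4dc7f7afbfe9e955c7fbe1865cdbb1a8e672028cc6c4f7dba7fb83) of the sdp seat's hybrid pipeline, verified by the cell's two exact verifiers), converted by
`cert2lean_g9.py` (lp gen 9; S = 62) into the units of the kernel checker `ThreePointCert.Check` + `CheckSym2` with the
record degree field set to L = 24 (the checker's degree enters only the unit `W = 2^d·d!` and the side conditions, so a
(d, L) certificate is a `Cert3` of degree L); Gram factors offset-encoded for the Kronecker-packed chunk validation
`ThreePointCert.CheckKron`; split check of (ii') `ThreePointCert.CheckSym2Split`. Emitter `emitlean_g9b.py` (lp gen 9, after lp gen 8's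
K5d14 layout). Generated file: plain lists of integers / monomials.
-/

namespace Summit.Ventures.PackingBounds.ThreePointCert.K9d12

open Literature.Geometry.DiscreteGeometry Literature.Geometry.DiscreteGeometry.PolyCert PolyCert.SPoly

set_option maxRecDepth 100000 in
set_option maxHeartbeats 0 in
/-- Block `R0`: rows from 283 (22 rows) of `zᵀ(LLᵀ)z` added to `dR0c9` give `dR0c10` (kernel, Kronecker-packed chunk check). -/
theorem okR0_10 : chunkOKK K9d12.gR0K 283 22 K9d12.dR0c9 K9d12.dR0c10 = true := by
  decide +kernel

set_option maxRecDepth 100000 in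
set_option maxHeartbeats 0 in
/-- Block `R0`: rows from 305 (21 rows) of `zᵀ(LLᵀ)z` added to `dR0c10` give `dR0c11` (kernel, Kronecker-packed chunk check). -/
theorem okR0_11 : chunkOKK K9d12.gR0K 305 21 K9d12.dR0c10 K9d12.dR0c11 = true := by
  decide +kernel

set_option maxRecDepth 100000 in
set_option maxHeartbeats 0 in
/-- Block `R0`: rows from 326 (21 rows) of `zᵀ(LLᵀ)z` added to `dR0c11` give `dR0c12` (kernel, Kronecker-packed chunk check). -/
theorem okR0_12 : chunkOKK K9d12.gR0K 326 21 K9d12.dR0c11 K9d12.dR0c12 = true := by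
  decide +kernel

end Summit.Ventures.PackingBounds.ThreePointCert.K9d12
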